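import Literature.AnabelianGeometry.AbsoluteAnabelian.AbsTopIII.KummerCuspLaws
import Literature.AnabelianGeometry.AbsoluteAnabelian.AbsTopIII.Thm19CuspidalDegree
import HarnessLib

/-!
# [AbsTopIII] §1: the `CurveModel` interface with SEPARATION laws for decomposition groups and the
# TRANSPORT law for cuspidal degrees (successor structure, layer V; statements only)

Mochizuki, *Topics in Absolute Anabelian Geometry III*, §1, Thm. 1.9 (d)(e) pp. 37–38, Prop. 1.6 (ii) p. 34,
Prop. 1.4 (i)(ii) p. 31 (lit key `paper:url-5493eb38cbb7`).

Fifth layer of the "ONE SOURCE OF LAWS" tower of the abc-iut cell (abc-iut-L4-lead RULINGS #3z/#4a/#5j):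
`IntrinsicKummerModel ⊆ NaturalKummerModel ⊆ TowerKummerModel ⊆ DescentKummerModel ⊆ CoherentKummerModel`
(abc-iut-L4-t1, layers I–IV) `⊆ SeparatedKummerModel` (THIS FILE, abc-iut-w5-d213 by RULING #5j (3), t1's
seat being closed).  PURPOSE: the (e)-BRIDGE of Thm. 1.9 — deriving abc-iut-w5-d213's per-system places
dictionary (`IntrinsicKummerModel.NFDictionary`, hence `Thm19eSat`) from the per-curve laws for SATURATED,
geometrically TAGGED systems — needs three more relations of the intended étale-`π₁` model that layers
I–IV do not carry:

* (S-fin) `point_eq_of_finiteIndex_le_conj` — SEPARATION of closed points by decomposition groups in the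
  finite-index-containment form: on a scheme-like curve of genus `≥ 2` over a Kummer-faithful field, if a
  finite-index subgroup of `D_{x′}` lies in a conjugate of `D_x` then `x′ = x`.  OURS-DERIVED exactly as
  layer I's (S) `point_eq_of_decomp_conj` (which is the equality form): after the finite base change `L/k`
  cut out by the subgroup, both points acquire `L`-rational lifts with conjugate sections, and "the
  injectivity portion of the section conjecture" over the Kummer-faithful `L` (Prop. 1.6 (ii) p. 34:
  rational points are recovered from, hence separated by, the Kummer classes of the functions vanishing
  at them; finite extensions of Kummer-faithful fields are Kummer-faithful, Def. 1.5) identifies them.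
  This form is what "the decomposition group of a point of a LATER level lies over `x`" (the relation
  `LiesOver` of the extracted point index, `Thm19Evaluation.lean`) can be tested against.
* (S-bcfin) `decomp_bcPt_finiteIndex` — along a base-change leg `Z ×_k k′ → Z` the image of `D_{x′}` has
  FINITE index in (a conjugate of) `D_x`, `x` the image point (`[k′(x′) : k(x)] < ∞`; layer II's
  `decomp_bcPt` gives the containment only).
* (D-transport) `hasCuspidalDegree_transport` — cuspidal DEGREES read through THE synchronization
  (`CurveModel.HasCuspidalDegree`, Thm. 1.9 (b)(c)) are INVARIANT along the transitions of a tagged system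
  (`V_j ⊆ W → V_i` over `Z_j → Z_i`: open immersion followed by a base-change leg) at a cusp `c_j` lying
  over a cusp `c_i`: such transitions are UNRAMIFIED at the cusps (`I_{c_j} ⥲ I_{c_i}`) and the
  synchronization `I_z ⥲ M_Z` is natural in `(U ⊆ Z, z)` ("a cyclotomic synchronization isomorphism [...]
  for ANY universal étale covering", Thm. 1.9 (b) p. 37; Prop. 1.4 (ii) naturality of `M_X`).  Stated, like
  layer II's `kummer_bc`, as an `↔` between a class `η` at level `i` and any class `η′` at level `j` whose
  coefficient push-forward along `M_{Z_j} ⥲ M_{Z_i}` is the pull-back of `η`.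

All three are TRUE relations of the intended model; no new Prop FACT is introduced; (S-fin) carries the
«OURS» mark of layer I's (S).  The fourth relation asked for in the cell's request ((S-cusp): a CUSPIDAL
decomposition group never maps into a point's) is DERIVABLE (layer IV `decomp_cuspRes`/`decomp_inf_geom` +
nontrivial inertia) and therefore not a law.  HONEST FRAMING: interface data; statements-first; typed ≠
proved; nothing here bears on [IUTchIII] Cor. 3.12.
-/

noncomputable section

open CategoryTheory
open scoped Pointwise

namespace Literature.AnabelianGeometry.AbsoluteAnabelian.AbsTopIII

universe u

/-- **The curve interface with separation and degree-transport laws** (layer V over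
`CoherentKummerModel`): (S-fin) finite-index subgroups of decomposition groups of distinct closed points
are not conjugate into one another (genus `≥ 2`, scheme-like, Kummer-faithful base — OURS-derived from
Prop. 1.6 (ii) as layer I's (S)); (S-bcfin) finite index of decomposition groups along base-change legs;
(D-transport) invariance of cuspidal degrees through THE synchronization along unramified transitions.
Interface data (relations of the intended model), no Prop-valued named fact.
[cite: MochizukiAbsTopIII2015, Thm 1.9 (e) p.38] -/
structure SeparatedKummerModel : Type (u + 2) extends CoherentKummerModel.{u} where
  /-- (S-fin, OURS-derived from Prop. 1.6 (ii) p. 34 as layer I's (S)) SEPARATION: on a scheme-like curve of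
  genus `≥ 2` over a Kummer-faithful field, a subgroup of FINITE index of `D_{x′}` lies in a conjugate of
  `D_x` only if `x′ = x` (injectivity of sections after the finite base change the subgroup cuts out). -/
  point_eq_of_finiteIndex_le_conj : ∀ (X : Curve), IsScheme X → 2 ≤ genus X →
    IsKummerFaithful (base X) → ∀ (x x' : Point X) (H : Subgroup (ext X).arith) (g : (ext X).arith),
      H ≤ decomp X x' → H.relIndex (decomp X x') ≠ 0 → H ≤ MulAut.conj g • decomp X x → x' = x
  /-- (S-bcfin) along `Z′ = Z ×_k k′ → Z`, `D_{x′}` maps onto a FINITE-INDEX subgroup of a conjugate of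
  `D_x`, `x` the image point ("`[k′(x′) : k(x)] < ∞`"; refines layer II's `decomp_bcPt`). -/
  decomp_bcPt_finiteIndex : ∀ {Z' Z : Curve} (h : IsBaseChangeOf Z' Z) (x' : Point Z'),
    ∃ g : (ext Z).arith,
      (decomp Z' x').map (bc h).arith.toMonoidHom ≤ MulAut.conj g • decomp Z (bcPt h x') ∧
        ((decomp Z' x').map (bc h).arith.toMonoidHom).relIndex
            (MulAut.conj g • decomp Z (bcPt h x')) ≠ 0
  /-- (D-transport, Thm. 1.9 (b)(c) p. 37: "a cyclotomic synchronization isomorphism [...] for any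
  universal étale covering" — naturality of THE synchronization; transitions of a tagged system are
  unramified at the cusps) for a factored transition `t = (V_j ⊆ W) ≫ (W → V_i)` over the base-change leg
  `Z_j → Z_i` (commuting square `hsq`), presentations `P_i`, `P_j`, a cusp `c_j` of `V_j` LYING OVER the
  cusp `c_i` of `V_i` (`t(D_{c_j}) ⊆ g D_{c_i} g⁻¹`), and classes `η` (level `i`), `η′` (level `j`) with
  `(M_{Z_j} ⥲ M_{Z_i})_* η′ = t^* η`: `η` has degree `n` at `c_i` iff `η′` has degree `n` at `c_j`. -/
  hasCuspidalDegree_transport : ∀ {Vj W Zj Vi Zi : Curve} (hVW : IsCofiniteOpen Vj W)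
    (hWV : IsBaseChangeOf W Vi) (hj : IsCofiniteOpen Vj Zj) (hZZ : IsBaseChangeOf Zj Zi)
    (hi : IsCofiniteOpen Vi Zi) (hsq : (res hVW ≫ bc hWV) ≫ res hi = res hj ≫ bc hZZ)
    (Pi : toCurveModel.CuspSyncPresentation hi) (Pj : toCurveModel.CuspSyncPresentation hj)
    (ci : (cusps Vi).Cusp) (cj : (cusps Vj).Cusp) (g : (ext Vi).arith),
    ((cusps Vj).Dcusp cj).map (res hVW ≫ bc hWV).arith.toMonoidHom ≤
      MulAut.conj g • (cusps Vi).Dcusp ci →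
    ∀ (η : cyclotomeModH1 (res hi) ZHatCoeff.{u}) (η' : cyclotomeModH1 (res hj) ZHatCoeff.{u}) (n : ℤ),
      (cyclotomeModH1Push ZHatCoeff.{u} (res hj) (bc hZZ)).hom η' =
        (cyclotomeModH1Pull ZHatCoeff.{u} (res hVW ≫ bc hWV) (res hi) (res hj ≫ bc hZZ) hsq).hom η →
      (toCurveModel.HasCuspidalDegree Pi η ci n ↔ toCurveModel.HasCuspidalDegree Pj η' cj n)

end Literature.AnabelianGeometry.AbsoluteAnabelian.AbsTopIII

-- SUPERSEDED by KummerSeparationLawsV2.lean (abc-iut-L4-t1 F-t1g4-1; `SeparatedKummerModel.toV2`); 2026-08-26 comment-only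
-- re-land to rebuild this module against layer III v2 (p443108) on the gate build (stale-olean remedy, w4-d014 class).
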